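import Mathlib.Algebra.QuadraticAlgebra.Basic
import Mathlib.NumberTheory.Zsqrtd.Basic
import Mathlib.Analysis.SpecialFunctions.Pow.Real
import Mathlib.Tactic.NormNum
import Mathlib.Tactic.Ring
import Mathlib.Tactic.Linarith
import HarnessLib

/-!
# Venture HSemireg — the Hasse unit index inputs `Q = 2` behind `L(0,χ) = 4h_F∕(Q·w_F·h_{F⁺})` (ENGINE-W PROBE5 §33–§34, THEOREM 30-L) and
# the UNITS remarks of §10 (v1.6a): `2+√3 = ζ₁₂⁻¹(1+ζ₁₂)²`, `5+2√6 = −(√−2+√−3)²` (up to the sign of `√6`), `(3+√11)² = 2(10+3√11)`,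
# `(√3+√5)² = 2(4+√15)` — kernel arithmetic

HONEST FRAMING. Lean index of the computation cell `pub-hsemireg`, widening group ENGINE-W (code A, seat `engine-w-1`, gen 17). EXPLICIT
ARITHMETIC in towers of quadratic algebras (`ℚ(i)(√3) ⊇ ℚ(ζ₁₂)`, `ℚ(√−2)(√−3)`), in `ℤ[√11]` and in `ℝ`; no abelian variety, sheaf, `Ext`
group, hermitian lattice or L-function is constructed; nothing here says that HC, HC_CM or HC_AV holds. Theorems only (0 `def`, 0 named fact,
0 `sorry`). New namespace `HasseUnitIndex`; companion of `HermitianMassArithmetic.lean` (where `Q = 2` enters `L_values` by value).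

SOURCE (the cell's own result): `widen/ENGINE-W/out/probe5/PROBE5-STIZ-A.md` §33 (2) «`L(0, χ_{F∕F⁺}) = (h_F∕h_{F⁺})·2^d∕(Q·w_F)` … `ℚ(ζ₁₂)∕ℚ(√3)`:
`1·4∕(2·12) = 1∕6` (`Q = 2` for `ℚ(ζ₁₂)`); `ℚ(√−2,√−3)∕ℚ(√6)`: `4∕(2·6) = 1∕3` (`Q = 2`: `5+2√6 = −(√−2+√−3)²`)», §9 («for `m = 3`: `F = ℚ(ζ₁₂)`,
`O_F^× = μ₁₂ × ⟨1+ζ₁₂⟩` … `R^× = μ₆ × ⟨2+√3⟩ and N_{F∕F^τ}(R^×) = {1}` (`N(ζ₁₂²) = 1`, `N(2+√3) = 1`)») and §10 UNITS v1.6a («`ℚ(√11)`: …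
`ε₁₁ = 10+3√11` fundamental, norm 1 … `Q = 1` (`ε = ((3+√11)∕√2)²` … not squares in `F` since `√2, √−2 ∉ F` …)»; «`ℚ(√−5)`: … `Q = 1` likewise
(`η = ((√3+√5)∕√2)²` …)»). The unit-group STRUCTURES (Dirichlet, fundamental units, `√2 ∉ F`) stay BY VALUE; the kernel holds the identities:

* §1 (`F = ℚ(i)(√3)`, `ζ := (√3 + i)∕2`): `zeta_pow_six` (`ζ⁶ = −1`, `ζ⁴ ≠ 1`: a primitive 12th root of unity), **`two_add_sqrt_three_eq`**
  (`(1+ζ)² = ζ·(2+√3)`, i.e. `2+√3 = ζ⁻¹(1+ζ)² ∈ μ_F·F^{×2}` — the index-`2` phenomenon `Q = 2`), `norm_one_add_zeta` (`(1+ζ)(1+ζ̄) = 2+√3` with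
  `ζ̄ = (√3 − i)∕2`), `norm_two_add_sqrt_three` (`(2+√3)(2−√3) = 1`).
* §2 (`F = ℚ(√−2)(√−3)`, `σ := √−2·√−3`, `σ² = 6`): **`five_sub_two_sigma`** (`−(√−2+√−3)² = 5 − 2σ`), `unit_norm` (`(5 − 2σ)(5 + 2σ) = 1`) — so the
  fundamental unit `5 ± 2√6` of `ℚ(√6)` is `−1` times a square in `F` (`Q = 2`), the sign of `√6 = ∓σ` being a convention.
* §3 `Q = 1` witnesses as printed: `(3 + √11)² = 2·(10 + 3√11)` in `ℤ√11` and `N(10+3√11) = 1`; `(√3 + √5)² = 2·(4 + √15)` and `N(4+√15) = 1`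
  in `ℝ`.
-/

namespace Summit.Ventures.HSemireg.HasseUnitIndex

open QuadraticAlgebra

/-! ## §1 `ℚ(ζ₁₂) = ℚ(i, √3)`: `2 + √3 = ζ₁₂⁻¹(1 + ζ₁₂)²` -/

/-- The model: `K = ℚ(i) = QuadraticAlgebra ℚ (−1) 0`, `F = K(√3) = QuadraticAlgebra K 3 0`; `ζ = (√3 + i)∕2 = ⟨⟨0, ½⟩, ⟨½, 0⟩⟩`
(`K`-coordinates `(i∕2) + (1∕2)·√3`). Then `ζ² = ⟨⟨½, 0⟩, ⟨0, ½⟩⟩·… `; concretely **`ζ⁶ = −1`** and `ζ⁴ ≠ 1`. [kernel] -/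
theorem zeta_pow_six :
    ((⟨⟨0, 1/2⟩, ⟨1/2, 0⟩⟩ : QuadraticAlgebra (QuadraticAlgebra ℚ (-1) 0) 3 0) ^ 6 = -1) ∧
    ((⟨⟨0, 1/2⟩, ⟨1/2, 0⟩⟩ : QuadraticAlgebra (QuadraticAlgebra ℚ (-1) 0) 3 0) ^ 4 ≠ 1) := by
  refine ⟨?_, ?_⟩
  · ext <;> simp [pow_succ] <;> norm_num
  · intro h
    have := congrArg (fun z => z.re.re) h
    simp [pow_succ] at this
    norm_num at this

/-- **`(1 + ζ)² = ζ·(2 + √3)`** with `√3 = ⟨0, 1⟩` over `K`: so `2 + √3 = ζ⁻¹(1+ζ)²` lies in `μ_F·(F^×)²` — the Hasse unit index of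
`ℚ(ζ₁₂)∕ℚ(√3)` is `Q = 2` (given that `2+√3` is the fundamental unit, by value). [kernel] -/
theorem two_add_sqrt_three_eq :
    (1 + (⟨⟨0, 1/2⟩, ⟨1/2, 0⟩⟩ : QuadraticAlgebra (QuadraticAlgebra ℚ (-1) 0) 3 0)) ^ 2
      = (⟨⟨0, 1/2⟩, ⟨1/2, 0⟩⟩ : QuadraticAlgebra (QuadraticAlgebra ℚ (-1) 0) 3 0) * (2 + ⟨0, 1⟩) := by
  ext <;> simp [pow_succ] <;> norm_num

/-- **`N_{F∕F⁺}(1 + ζ₁₂) = (1+ζ)(1+ζ̄) = 2 + √3`** with `ζ̄ = (√3 − i)∕2` (complex conjugation fixes `√3`, negates `i`). [kernel] -/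
theorem norm_one_add_zeta :
    (1 + (⟨⟨0, 1/2⟩, ⟨1/2, 0⟩⟩ : QuadraticAlgebra (QuadraticAlgebra ℚ (-1) 0) 3 0))
        * (1 + ⟨⟨0, -1/2⟩, ⟨1/2, 0⟩⟩) = 2 + ⟨0, 1⟩ := by
  ext <;> simp <;> norm_num

/-- `N(2 + √3) = (2 + √3)(2 − √3) = 1` (the unit of `ℤ[√3]`; «`N(2+√3) = 1`»). [kernel] -/
theorem norm_two_add_sqrt_three : (⟨2, 1⟩ : ℤ√3).norm = 1 ∧ (⟨2, 1⟩ : ℤ√3) * ⟨2, -1⟩ = 1 := by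
  refine ⟨by simp only [Zsqrtd.norm_def]; decide, ?_⟩
  ext <;> simp

/-! ## §2 `ℚ(√−2, √−3)`: `5 ± 2√6` is `−1` times a square -/

/-- The model: `K = ℚ(√−2) = QuadraticAlgebra ℚ (−2) 0`, `F = K(√−3) = QuadraticAlgebra K (−3) 0`, `σ := √−2·√−3 = ⟨0, √−2⟩ = ⟨⟨0,0⟩,⟨0,1⟩⟩`,
`σ² = 6`; and **`−(√−2 + √−3)² = 5 − 2σ`** (the printed «`5+2√6 = −(√−2+√−3)²`» with `√6 := −σ`). [kernel] -/
theorem five_sub_two_sigma :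
    ((⟨⟨0, 0⟩, ⟨0, 1⟩⟩ : QuadraticAlgebra (QuadraticAlgebra ℚ (-2) 0) (-3) 0) ^ 2 = 6) ∧
    (-((⟨⟨0, 1⟩, ⟨0, 0⟩⟩ + ⟨⟨0, 0⟩, ⟨1, 0⟩⟩ : QuadraticAlgebra (QuadraticAlgebra ℚ (-2) 0) (-3) 0) ^ 2)
      = 5 - 2 * ⟨⟨0, 0⟩, ⟨0, 1⟩⟩) := by
  refine ⟨?_, ?_⟩
  · (ext <;> simp [pow_succ]); norm_num
  · ext <;> simp [pow_succ] <;> norm_num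

/-- `(5 − 2σ)(5 + 2σ) = 25 − 4·6 = 1`: `5 ± 2σ` are units of norm `1` (the fundamental unit of `ℚ(√6)` and its inverse, by value), so `Q = 2`
for `ℚ(√−2,√−3)∕ℚ(√6)`. [kernel] -/
theorem unit_norm :
    ((5 : QuadraticAlgebra (QuadraticAlgebra ℚ (-2) 0) (-3) 0) - 2 * ⟨⟨0, 0⟩, ⟨0, 1⟩⟩) * (5 + 2 * ⟨⟨0, 0⟩, ⟨0, 1⟩⟩) = 1 ∧
    (⟨5, 2⟩ : ℤ√6).norm = 1 := by
  refine ⟨?_, by simp only [Zsqrtd.norm_def]; decide⟩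
  ext <;> simp <;> norm_num

/-! ## §3 The `Q = 1` witnesses as printed -/

/-- «`ε₁₁ = 10+3√11` … norm `1`» and «`ε = ((3+√11)∕√2)²`»: `(3 + √11)² = 2·(10 + 3√11)` in `ℤ√11`, `N(10 + 3√11) = 1`. [kernel] -/
theorem sqrt_eleven_unit : (⟨3, 1⟩ : ℤ√11) * ⟨3, 1⟩ = 2 * ⟨10, 3⟩ ∧ (⟨10, 3⟩ : ℤ√11).norm = 1 := by
  refine ⟨?_, by simp only [Zsqrtd.norm_def]; decide⟩
  ext <;> simp

/-- «`η = 4+√15`», «`η = ((√3+√5)∕√2)²`»: `(√3 + √5)² = 2·(4 + √15)` in `ℝ`, and `N(4 + √15) = 16 − 15 = 1`. [kernel] -/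
theorem sqrt_fifteen_unit :
    (Real.sqrt 3 + Real.sqrt 5) ^ 2 = 2 * (4 + Real.sqrt 15) ∧ (⟨4, 1⟩ : ℤ√15).norm = 1 := by
  refine ⟨?_, by simp only [Zsqrtd.norm_def]; decide⟩
  have h3 : Real.sqrt 3 ^ 2 = 3 := Real.sq_sqrt (by norm_num)
  have h5 : Real.sqrt 5 ^ 2 = 5 := Real.sq_sqrt (by norm_num)
  have h15 : Real.sqrt 3 * Real.sqrt 5 = Real.sqrt 15 := by
    rw [← Real.sqrt_mul (by norm_num : (0:ℝ) ≤ 3)]; norm_num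
  nlinarith [h3, h5, h15]

end Summit.Ventures.HSemireg.HasseUnitIndex
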